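import Summits.Ventures.QEC.Census.CertChunks
import Summits.Ventures.QEC.Census.BB.BB72.Cert
import HarnessLib

/-!
# `BB72` — KERNEL-tier lower-bound replay, side X, leaf file 3/10 (emitted by qec-search-7)

Bruteforce replay (CERT-FORMAT v1 §5.1, lemma L3) of the certificate `7e943c5a566adc43`: every X-type operator of weight
`1 … 5` has nonzero syndrome (rows `cert.HZ`) or is allow-listed (allow-list []). This file holds
9 packed chunk evaluations (`chunk1R`/`chunk2R` of `Census/CertChunks.lean` over `posList 72 cert.HZ`), total
1495783 scan end points, each closed by `decide +kernel` — tier KERNEL (CERTIFIED): axioms ⊆ {propext, Classical.choice,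
Quot.sound}. Assembled in `BB/BB72/KernelX.lean`. Do not edit; re-emit (HOME/census/search-7/emit_kernel.py).
-/

namespace Summit.Ventures.QEC.Census.BB72

/-- Level-2 chunks `(3, j)`, `4 ≤ j < 9`, side X of `BB72` (189715 end points): pass. -/
theorem kX2_3_4 : chunk2R (leafTest []) (posList 72 cert.HZ) 3 3 4 5 = true := by decide +kernel

/-- Level-2 chunks `(3, j)`, `9 ≤ j < 16`, side X of `BB72` (195202 end points): pass. -/
theorem kX2_3_9 : chunk2R (leafTest []) (posList 72 cert.HZ) 3 3 9 7 = true := by decide +kernel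

/-- Level-2 chunks `(3, j)`, `16 ≤ j < 28`, side X of `BB72` (192113 end points): pass. -/
theorem kX2_3_16 : chunk2R (leafTest []) (posList 72 cert.HZ) 3 3 16 12 = true := by decide +kernel

/-- Level-2 chunks `(3, j)`, `28 ≤ j < 68`, side X of `BB72` (102090 end points): pass. -/
theorem kX2_3_28 : chunk2R (leafTest []) (posList 72 cert.HZ) 3 3 28 40 = true := by decide +kernel

/-- Level-2 chunks `(4, j)`, `0 ≤ j < 4`, side X of `BB72` (179271 end points): pass. -/
theorem kX2_4_0 : chunk2R (leafTest []) (posList 72 cert.HZ) 3 4 0 4 = true := by decide +kernel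

/-- Level-2 chunks `(4, j)`, `4 ≤ j < 9`, side X of `BB72` (180555 end points): pass. -/
theorem kX2_4_4 : chunk2R (leafTest []) (posList 72 cert.HZ) 3 4 4 5 = true := by decide +kernel

/-- Level-2 chunks `(4, j)`, `9 ≤ j < 16`, side X of `BB72` (184786 end points): pass. -/
theorem kX2_4_9 : chunk2R (leafTest []) (posList 72 cert.HZ) 3 4 9 7 = true := by decide +kernel

/-- Level-2 chunks `(4, j)`, `16 ≤ j < 30`, side X of `BB72` (197533 end points): pass. -/
theorem kX2_4_16 : chunk2R (leafTest []) (posList 72 cert.HZ) 3 4 16 14 = true := by decide +kernel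

/-- Level-2 chunks `(4, j)`, `30 ≤ j < 67`, side X of `BB72` (74518 end points): pass. -/
theorem kX2_4_30 : chunk2R (leafTest []) (posList 72 cert.HZ) 3 4 30 37 = true := by decide +kernel

end Summit.Ventures.QEC.Census.BB72
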